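/-
Copyright (c) 2026 the pub-hodgecm-mathlib formalisation cell (harness21).  Prover seat hodgecm-mathlib-K2E4-p14 (g9), Track B ∕ K2-LIT, h413 = `stmt-HodgeConjecture-24833`,
line `K2_E1_TraceFormulaBeta`, campaign «EIS-R7-BL-SPH-3», deal (236) of the dealer K2E1-plan (g7): (RES)₃ — the `N = 3` TWIN of ★ p860232 `K2E1SphericalEisensteinL2ResidueCMTwo`
(K2E1-p12 (g2)): the `L²` residue `Res_T = lim_{z→2} (z − 2)•F_T(z)` of the truncated spherical Eisenstein family of `U(2,1)∕CM` exists as soon as (MS-2) holds, ★ K2E4-p10's (RES)₃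
heads with `(Res, hRes)` discharged by (MS-2), and the road edition where (MS-2) itself is ★ `ms2_of_road` (this seat, FILE 3).
-/
import Summits.HodgeConjecture.HodgeConjecture.Theorems.K2E1SphericalEisensteinL2ResidueCMTwo            -- ★ p860232 (K2E1-p12): §1 Banach-valued residue bricks `exists_tendsto_sub_smul_of_…` (N-free, REUSED BY NAME)
import Summits.HodgeConjecture.HodgeConjecture.Theorems.K2E1SphericalEisensteinResidueCuspidalCMThree    -- ★ p859768 (K2E4-p10): `residueValue_eq_const_cm_three`, `exists_analyticAt_remainder_cm_three`; brings ★ p859742 `ae_eq_residueValue_sub_indicator` (UThree)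
import Summits.HodgeConjecture.HodgeConjecture.Theorems.K2E1SphericalEisensteinL2BoundCMThree             -- ★ p860218 (this seat) FILE 3: `ms2_of_road`
import HarnessLib

/-!
# K2·E1 — `K2E1SphericalEisensteinL2ResidueCMThree` ((RES)₃, `U(2,1)_{L/L⁺}`): THE `L²` RESIDUE `Res_T = lim_{z→2} (z − 2)•F_T(z)` EXISTS AS SOON AS `‖(z − 2)•F_T(z)‖_{L²}` IS
# BOUNDED NEAR `2` (MS-2) — ★ p859768's residue theorem with `(Res, hRes)` discharged — and, in the road's currency, with (MS-2) itself discharged by ★ `ms2_of_road`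

Track B ∕ K2-LIT, crux h413 = `stmt-HodgeConjecture-24833`, route of record `HCCMUnconditional`; cell `hodgecm-mathlib`, squad K2, ENGINE E1.  Prover seat `hodgecm-mathlib-K2E4-p14` (g9);
deal (236) of the dealer K2E1-plan (g7): the byte-twin at `N = 3` (pole `2`, Godement half-plane `{2 < Re}`, `H^{2−z}`) of ★ p860232 `K2E1SphericalEisensteinL2ResidueCMTwo` (K2E1-p12 (g2),
(225) FILE γ), on this seat's ★ `ms2_of_road` (p860218).  As there: an `L²(μ)`-valued function HOLOMORPHIC on a punctured neighbourhood of `2` and with `‖(z − 2)•F z‖` BOUNDED there has a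
removable singularity after the weight (Riemann, Banach-valued: ★ `K2E1BLRemovablePolesU.exists_analyticAt_eventuallyEq_of_differentiableAt_of_eventually_norm_le`), so `(z − 2)•F_T(z)`
CONVERGES — ★ p860232 §1, REUSED BY NAME.  THEOREMS ONLY (no `def`, no `instance`, no notation, no named-fact hypothesis, no `sorry`); lane `--supports stmt-HodgeConjecture-24833 --as helper`
(count-neutral).  Closes no socket.
* §2 (`U(2,1)∕CM`, ★ p859768's domain currency) **`exists_L2Residue_cm_three`** (the residue class + its a.e. identification `Res_T =ᵐ (x ↦ F x̃⁻¹ 2 − 𝟙[T < w₁ x]·φ₀r)`, ★ p859742),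
  **`residueValue_eq_const_cm_three_of_ms`** and **`exists_analyticAt_remainder_cm_three_of_ms`** — ★ p859768's two heads with `(Res, hRes)` REPLACED by (MS-2)
  `hMS2 : ∃ C, ∀ᶠ z in 𝓝[≠] 2, ‖(z − 2)•F_T z‖ ≤ C`.
* §3 (the road's currency) **`exists_L2Residue_of_road_cm_three`** — for a road family (one ball, `U ∖ P`, one level) the `L²` residue at `2` EXISTS, (MS-2) being ★ `ms2_of_road`:
  no Maass–Selberg letter left (structural measures + (L3)₃ scalar letters + the ball's `U, P, Ec, Fam` data only).
HONEST LABEL: HC_CM is proved only modulo the 7 printed citations (2 remaining named inputs: hLiu418 = `stmt-HodgeConjecture-24832`, h413 = `stmt-HodgeConjecture-24833`) until rung 0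
closes; this file asserts no named fact and closes no socket; remaining visible letters of §2: EXPORTS₃ (E1)(E2)(E2-bd)(E4)(E3′)₃, (F), `hcres`, the operator road's `(F_T, hFd, hFam)` and
(MS-2); of §3: the road data only.
References: [MoeglinWaldspurger1995] IV.1.9–IV.1.11 · [BernsteinLapid2019] §4 p. 10 · [Langlands1976] §7.
-/

set_option autoImplicit false
-- the mandated namespace repeats the single-problem summit's segment (`HodgeConjecture.HodgeConjecture`)
set_option linter.dupNamespace false

noncomputable section

open MeasureTheory Measure NumberField IsDedekindDomain Set Filter Topology Metric
open scoped ENNReal NNReal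
open Literature.MeasureTheory.Group Literature.NumberTheory
open Literature.NumberTheory.Automorphic Literature.NumberTheory.Automorphic.UnitaryGroup AdelicGroupData
open Summit.HodgeConjecture.HodgeConjecture.Cruxes.H413.K2E1BorelEisensteinU
open Summit.HodgeConjecture.HodgeConjecture.Cruxes.H413.K2E1BLBorelSpacesU2Defs
open Summit.HodgeConjecture.HodgeConjecture.Cruxes.H413.K2E1SphericalEisensteinL2ResidueCMTwo (exists_tendsto_sub_smul_of_differentiableOn)
open Summit.HodgeConjecture.HodgeConjecture.Cruxes.H413.K2E1ContinuedEisensteinResidueFunctionUThree (ae_eq_residueValue_sub_indicator)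
open Summit.HodgeConjecture.HodgeConjecture.Cruxes.H413.K2E1SphericalEisensteinResidueCuspidalCMThree (residueValue_eq_const_cm_three exists_analyticAt_remainder_cm_three)
open Summit.HodgeConjecture.HodgeConjecture.Cruxes.H413.K2E1SphericalEisensteinL2BoundCMThree (ms2_of_road)

namespace Summit.HodgeConjecture.HodgeConjecture.Cruxes.H413.K2E1SphericalEisensteinL2ResidueCMThree

/-! ## §2 `U(2,1)∕CM`: the `L²` residue of the truncated spherical Eisenstein family at `2`, and ★ p859768 with `(Res, hRes)` discharged by (MS-2) -/

section CM

variable (L : Type) [Field L] [NumberField L] [IsCMField L]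
variable [MeasurableSpace (quasiSplit (↥(maximalRealSubfield L)) L (IsCMField.complexConj L) 3).Adelic] [BorelSpace (quasiSplit (↥(maximalRealSubfield L)) L (IsCMField.complexConj L) 3).Adelic]

/-- **THE `L²` RESIDUE CLASS OF THE TRUNCATED SPHERICAL EISENSTEIN FAMILY OF `U(2,1)` AT `z = 2` EXISTS AND IS `Res Ẽ − φ₀r·𝟙_{T<w₁}` A.E.**: for the operator road's family `F_T : ℂ → L²(μ)`,
holomorphic on an open `D ⊇ B(2,ρ)∖{2}` with `F_T(z) =ᵐ Λ^T Ẽ(z)`, the Maass–Selberg letter (MS-2) `‖(z − 2)•F_T z‖ ≤ C` near `2` gives `Res_T := lim (z − 2)•F_T(z)` in `L²(μ)` (§1), and ★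
p859742 (UThree) identifies it: `Res_T(x) = F x̃⁻¹ 2 − 𝟙[T < w₁ x]·φ₀r` for a.e. `x` (letters: `G(F)`-invariance `hEcinv`, (E3′)₃ `hE3`, `hcres`, the pole letter (F) `hF hFE`).
[cite: MoeglinWaldspurger1995, IV.1.9–IV.1.11] [cite: BernsteinLapid2019, §4 p. 10] -/
theorem exists_L2Residue_cm_three
    (μ : Measure (quasiSplit (↥(maximalRealSubfield L)) L (IsCMField.complexConj L) 3).automorphicQuotient)
    (ν : Measure ↥(adelicUnipotent (↥(maximalRealSubfield L)) L (IsCMField.complexConj L) 3)) [ν.IsHaarMeasure]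
    {𝓕 : Set ↥(adelicUnipotent (↥(maximalRealSubfield L)) L (IsCMField.complexConj L) 3)}
    (h𝓕N : IsFundamentalDomain ↥(rationalUnipotent (↥(maximalRealSubfield L)) L (IsCMField.complexConj L) 3) 𝓕 ν) {T : ℝ≥0} (hT : 1 ≤ T) (φ₀ : ℂ)
    (Ec : ℂ → (quasiSplit (↥(maximalRealSubfield L)) L (IsCMField.complexConj L) 3).Adelic → ℂ) {D : Set ℂ} (hDo : IsOpen D) {ρ : ℝ} (hρ : 0 < ρ) (hρD : ∀ z : ℂ, z ≠ 2 → dist z 2 < ρ → z ∈ D)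
    (hEcinv : ∀ z ∈ D, ∀ (γ : (quasiSplit (↥(maximalRealSubfield L)) L (IsCMField.complexConj L) 3).arithmeticSubgroup) (x : (quasiSplit (↥(maximalRealSubfield L)) L (IsCMField.complexConj L) 3).Adelic),
      Ec z ((γ : (quasiSplit (↥(maximalRealSubfield L)) L (IsCMField.complexConj L) 3).Adelic) * x) = Ec z x)
    {cc : ℂ → ℂ} {r : ℂ} (hcres : Tendsto (fun z : ℂ => (z - 2) * cc z) (𝓝[≠] 2) (𝓝 r))
    (hE3 : ∀ z ∈ D, ∀ g : (quasiSplit (↥(maximalRealSubfield L)) L (IsCMField.complexConj L) 3).Adelic,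
      borelConstantTerm ν 𝓕 (Ec z) g = φ₀ * ((((borelHeight g : ℝ≥0) : ℝ) : ℂ) ^ z + cc z * (((borelHeight g : ℝ≥0) : ℝ) : ℂ) ^ (2 - z)))
    (Fp : (quasiSplit (↥(maximalRealSubfield L)) L (IsCMField.complexConj L) 3).Adelic → ℂ → ℂ) (hF : ∀ g, AnalyticAt ℂ (Fp g) 2) (hFE : ∀ g, Fp g =ᶠ[𝓝[≠] 2] fun z => (z - 2) * Ec z g)
    (Fam : ℂ → (quasiSplit (↥(maximalRealSubfield L)) L (IsCMField.complexConj L) 3).L2 μ) (hFd : DifferentiableOn ℂ Fam D)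
    (hFam : ∀ z ∈ D, ((Fam z : (quasiSplit (↥(maximalRealSubfield L)) L (IsCMField.complexConj L) 3).L2 μ) : (quasiSplit (↥(maximalRealSubfield L)) L (IsCMField.complexConj L) 3).automorphicQuotient → ℂ) =ᵐ[μ]
      (quasiSplit (↥(maximalRealSubfield L)) L (IsCMField.complexConj L) 3).quotFun (truncation ν 𝓕 T (Ec z)))
    (hMS2 : ∃ C : ℝ, ∀ᶠ z in 𝓝[≠] (2 : ℂ), ‖(z - 2) • Fam z‖ ≤ C) :
    ∃ Res : (quasiSplit (↥(maximalRealSubfield L)) L (IsCMField.complexConj L) 3).L2 μ, Tendsto (fun z : ℂ => (z - 2) • Fam z) (𝓝[≠] 2) (𝓝 Res) ∧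
      ((Res : (quasiSplit (↥(maximalRealSubfield L)) L (IsCMField.complexConj L) 3).L2 μ) : (quasiSplit (↥(maximalRealSubfield L)) L (IsCMField.complexConj L) 3).automorphicQuotient → ℂ) =ᵐ[μ] fun x =>
        Fp (Quotient.out (x : (quasiSplit (↥(maximalRealSubfield L)) L (IsCMField.complexConj L) 3).Adelic ⧸ (quasiSplit (↥(maximalRealSubfield L)) L (IsCMField.complexConj L) 3).quotientSubgroup))⁻¹ 2 -
          if T < supHeight (↥(maximalRealSubfield L)) L (IsCMField.complexConj L) 3 x then φ₀ * r else 0 := by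
  have hD2 : ∀ᶠ z in 𝓝[≠] (2 : ℂ), z ∈ D := by
    filter_upwards [inter_mem_nhdsWithin _ (ball_mem_nhds (2 : ℂ) hρ)] with z hz
    exact hρD z hz.1 (mem_ball.1 hz.2)
  obtain ⟨Res, hRes⟩ := exists_tendsto_sub_smul_of_differentiableOn hDo hD2 hFd hMS2
  exact ⟨Res, hRes, ae_eq_residueValue_sub_indicator μ ν h𝓕N hT φ₀ Ec hD2 hEcinv hcres hE3 Fp hF hFE Fam hFam Res hRes⟩

/-- **THE RESIDUE AT `z = 2` IS THE CONSTANT `φ₀·r`, WITH `(Res, hRes)` DISCHARGED BY (MS-2)**: ★ `residueValue_eq_const_cm_three` (p860098) with its last two binders `(Res) (hRes)` replaced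
by the single Maass–Selberg letter `hMS2 : ∃ C, ∀ᶠ z in 𝓝[≠] 1, ‖(z − 2)•F_T z‖ ≤ C` (§1 supplies the `L²` residue).  All other binders VERBATIM.
[cite: MoeglinWaldspurger1995, IV.1.11] [cite: Langlands1976, §7] [cite: BernsteinLapid2019, §4 p. 10] -/
theorem residueValue_eq_const_cm_three_of_ms
    (μ : Measure (quasiSplit (↥(maximalRealSubfield L)) L (IsCMField.complexConj L) 3).automorphicQuotient) [(quasiSplit (↥(maximalRealSubfield L)) L (IsCMField.complexConj L) 3).IsAutomorphicMeasure μ]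
    (ν : Measure ↥(adelicUnipotent (↥(maximalRealSubfield L)) L (IsCMField.complexConj L) 3)) [ν.IsHaarMeasure]
    {𝓕 : Set ↥(adelicUnipotent (↥(maximalRealSubfield L)) L (IsCMField.complexConj L) 3)}
    (h𝓕N : IsFundamentalDomain ↥(rationalUnipotent (↥(maximalRealSubfield L)) L (IsCMField.complexConj L) 3) 𝓕 ν) (h𝓕c : IsCompact (closure 𝓕))
    (φ₀ : ℂ) {T : ℝ≥0} (hT : 1 ≤ T)
    (Ec : ℂ → (quasiSplit (↥(maximalRealSubfield L)) L (IsCMField.complexConj L) 3).Adelic → ℂ) {D : Set ℂ} (hDo : IsOpen D) (hDc : IsPreconnected D)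
    {σ₀ : ℝ} (hσ₀ : 2 < σ₀) (hσD : ∀ᶠ z in 𝓝 ((σ₀ : ℝ) : ℂ), z ∈ D) {ρ : ℝ} (hρ : 0 < ρ) (hρD : ∀ z : ℂ, z ≠ 2 → dist z 2 < ρ → z ∈ D)
    (hEd : ∀ g, DifferentiableOn ℂ (fun z => Ec z g) D) (hE4 : ∀ z ∈ D, Continuous (Ec z))
    (hEbd : ∀ z₀ ∈ D, ∀ K : Set (quasiSplit (↥(maximalRealSubfield L)) L (IsCMField.complexConj L) 3).Adelic, IsCompact K → ∃ V ∈ 𝓝 z₀, ∃ M : ℝ, ∀ z ∈ V, ∀ g ∈ K, ‖Ec z g‖ ≤ M)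
    (hEcinv : ∀ z ∈ D, ∀ (γ : (quasiSplit (↥(maximalRealSubfield L)) L (IsCMField.complexConj L) 3).arithmeticSubgroup) (x : (quasiSplit (↥(maximalRealSubfield L)) L (IsCMField.complexConj L) 3).Adelic),
      Ec z ((γ : (quasiSplit (↥(maximalRealSubfield L)) L (IsCMField.complexConj L) 3).Adelic) * x) = Ec z x)
    (hE2 : ∀ z ∈ D, 2 < z.re → Ec z = eisensteinSeriesU (flatSectionU (fun _ : (quasiSplit (↥(maximalRealSubfield L)) L (IsCMField.complexConj L) 3).Adelic => φ₀) z))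
    {cc : ℂ → ℂ} {r : ℂ} (hcres : Tendsto (fun z : ℂ => (z - 2) * cc z) (𝓝[≠] 2) (𝓝 r))
    (hE3 : ∀ z ∈ D, ∀ g : (quasiSplit (↥(maximalRealSubfield L)) L (IsCMField.complexConj L) 3).Adelic,
      borelConstantTerm ν 𝓕 (Ec z) g = φ₀ * ((((borelHeight g : ℝ≥0) : ℝ) : ℂ) ^ z + cc z * (((borelHeight g : ℝ≥0) : ℝ) : ℂ) ^ (2 - z)))
    (Fp : (quasiSplit (↥(maximalRealSubfield L)) L (IsCMField.complexConj L) 3).Adelic → ℂ → ℂ) (hF : ∀ g, AnalyticAt ℂ (Fp g) 2) (hFE : ∀ g, Fp g =ᶠ[𝓝[≠] 2] fun z => (z - 2) * Ec z g)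
    (Fam : ℂ → (quasiSplit (↥(maximalRealSubfield L)) L (IsCMField.complexConj L) 3).L2 μ) (hFd : DifferentiableOn ℂ Fam D)
    (hFam : ∀ z ∈ D, ((Fam z : (quasiSplit (↥(maximalRealSubfield L)) L (IsCMField.complexConj L) 3).L2 μ) : (quasiSplit (↥(maximalRealSubfield L)) L (IsCMField.complexConj L) 3).automorphicQuotient → ℂ) =ᵐ[μ]
      (quasiSplit (↥(maximalRealSubfield L)) L (IsCMField.complexConj L) 3).quotFun (truncation ν 𝓕 T (Ec z)))
    (hMS2 : ∃ C : ℝ, ∀ᶠ z in 𝓝[≠] (2 : ℂ), ‖(z - 2) • Fam z‖ ≤ C) :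
    ∀ g : (quasiSplit (↥(maximalRealSubfield L)) L (IsCMField.complexConj L) 3).Adelic, Fp g 2 = φ₀ * r := by
  have hD2 : ∀ᶠ z in 𝓝[≠] (2 : ℂ), z ∈ D := by
    filter_upwards [inter_mem_nhdsWithin _ (ball_mem_nhds (2 : ℂ) hρ)] with z hz
    exact hρD z hz.1 (mem_ball.1 hz.2)
  obtain ⟨Res, hRes⟩ := exists_tendsto_sub_smul_of_differentiableOn hDo hD2 hFd hMS2
  exact residueValue_eq_const_cm_three L μ ν h𝓕N h𝓕c φ₀ hT Ec hDo hDc hσ₀ hσD hρ hρD hEd hE4 hEbd hEcinv hE2 hcres hE3 Fp hF hFE Fam hFd hFam Res hRes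

/-- **THE (RES)₃ CONCLUSION OF ★ `hres_cm_three_of_letters`, WITH `(Res, hRes)` DISCHARGED BY (MS-2)**: ★ `exists_analyticAt_remainder_cm_three` (p860098) with its last two binders replaced by
`hMS2`. [cite: MoeglinWaldspurger1995, IV.1.11] [cite: Langlands1976, §7] -/
theorem exists_analyticAt_remainder_cm_three_of_ms
    (μ : Measure (quasiSplit (↥(maximalRealSubfield L)) L (IsCMField.complexConj L) 3).automorphicQuotient) [(quasiSplit (↥(maximalRealSubfield L)) L (IsCMField.complexConj L) 3).IsAutomorphicMeasure μ]
    (ν : Measure ↥(adelicUnipotent (↥(maximalRealSubfield L)) L (IsCMField.complexConj L) 3)) [ν.IsHaarMeasure]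
    {𝓕 : Set ↥(adelicUnipotent (↥(maximalRealSubfield L)) L (IsCMField.complexConj L) 3)}
    (h𝓕N : IsFundamentalDomain ↥(rationalUnipotent (↥(maximalRealSubfield L)) L (IsCMField.complexConj L) 3) 𝓕 ν) (h𝓕c : IsCompact (closure 𝓕))
    (φ₀ : ℂ) {T : ℝ≥0} (hT : 1 ≤ T)
    (Ec : ℂ → (quasiSplit (↥(maximalRealSubfield L)) L (IsCMField.complexConj L) 3).Adelic → ℂ) {D : Set ℂ} (hDo : IsOpen D) (hDc : IsPreconnected D)
    {σ₀ : ℝ} (hσ₀ : 2 < σ₀) (hσD : ∀ᶠ z in 𝓝 ((σ₀ : ℝ) : ℂ), z ∈ D) {ρ : ℝ} (hρ : 0 < ρ) (hρD : ∀ z : ℂ, z ≠ 2 → dist z 2 < ρ → z ∈ D)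
    (hEd : ∀ g, DifferentiableOn ℂ (fun z => Ec z g) D) (hE4 : ∀ z ∈ D, Continuous (Ec z))
    (hEbd : ∀ z₀ ∈ D, ∀ K : Set (quasiSplit (↥(maximalRealSubfield L)) L (IsCMField.complexConj L) 3).Adelic, IsCompact K → ∃ V ∈ 𝓝 z₀, ∃ M : ℝ, ∀ z ∈ V, ∀ g ∈ K, ‖Ec z g‖ ≤ M)
    (hEcinv : ∀ z ∈ D, ∀ (γ : (quasiSplit (↥(maximalRealSubfield L)) L (IsCMField.complexConj L) 3).arithmeticSubgroup) (x : (quasiSplit (↥(maximalRealSubfield L)) L (IsCMField.complexConj L) 3).Adelic),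
      Ec z ((γ : (quasiSplit (↥(maximalRealSubfield L)) L (IsCMField.complexConj L) 3).Adelic) * x) = Ec z x)
    (hE2 : ∀ z ∈ D, 2 < z.re → Ec z = eisensteinSeriesU (flatSectionU (fun _ : (quasiSplit (↥(maximalRealSubfield L)) L (IsCMField.complexConj L) 3).Adelic => φ₀) z))
    {cc : ℂ → ℂ} {r : ℂ} (hchol : DifferentiableOn ℂ cc ({z : ℂ | 1 < z.re} \ {2})) (hcres : Tendsto (fun z : ℂ => (z - 2) * cc z) (𝓝[≠] 2) (𝓝 r))
    (hE3 : ∀ z ∈ D, ∀ g : (quasiSplit (↥(maximalRealSubfield L)) L (IsCMField.complexConj L) 3).Adelic,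
      borelConstantTerm ν 𝓕 (Ec z) g = φ₀ * ((((borelHeight g : ℝ≥0) : ℝ) : ℂ) ^ z + cc z * (((borelHeight g : ℝ≥0) : ℝ) : ℂ) ^ (2 - z)))
    (Fp : (quasiSplit (↥(maximalRealSubfield L)) L (IsCMField.complexConj L) 3).Adelic → ℂ → ℂ) (hF : ∀ g, AnalyticAt ℂ (Fp g) 2) (hFE : ∀ g, Fp g =ᶠ[𝓝[≠] 2] fun z => (z - 2) * Ec z g)
    (Fam : ℂ → (quasiSplit (↥(maximalRealSubfield L)) L (IsCMField.complexConj L) 3).L2 μ) (hFd : DifferentiableOn ℂ Fam D)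
    (hFam : ∀ z ∈ D, ((Fam z : (quasiSplit (↥(maximalRealSubfield L)) L (IsCMField.complexConj L) 3).L2 μ) : (quasiSplit (↥(maximalRealSubfield L)) L (IsCMField.complexConj L) 3).automorphicQuotient → ℂ) =ᵐ[μ]
      (quasiSplit (↥(maximalRealSubfield L)) L (IsCMField.complexConj L) 3).quotFun (truncation ν 𝓕 T (Ec z)))
    (hMS2 : ∃ C : ℝ, ∀ᶠ z in 𝓝[≠] (2 : ℂ), ‖(z - 2) • Fam z‖ ≤ C) :
    ∀ g : (quasiSplit (↥(maximalRealSubfield L)) L (IsCMField.complexConj L) 3).Adelic, ∃ G : ℂ → ℂ, AnalyticAt ℂ G 2 ∧ G =ᶠ[𝓝[≠] 2] (fun z => Ec z g -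
      φ₀ * ((((borelHeight g : ℝ≥0) : ℝ) : ℂ) ^ z + cc z * (((borelHeight g : ℝ≥0) : ℝ) : ℂ) ^ ((2 : ℂ) - z))) := by
  have hD2 : ∀ᶠ z in 𝓝[≠] (2 : ℂ), z ∈ D := by
    filter_upwards [inter_mem_nhdsWithin _ (ball_mem_nhds (2 : ℂ) hρ)] with z hz
    exact hρD z hz.1 (mem_ball.1 hz.2)
  obtain ⟨Res, hRes⟩ := exists_tendsto_sub_smul_of_differentiableOn hDo hD2 hFd hMS2
  exact exists_analyticAt_remainder_cm_three L μ ν h𝓕N h𝓕c φ₀ hT Ec hDo hDc hσ₀ hσD hρ hρD hEd hE4 hEbd hEcinv hE2 hchol hcres hE3 Fp hF hFE Fam hFd hFam Res hRes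


section Road

variable [MeasurableSpace (AdeleRing (𝓞 L) L)ˣ] [BorelSpace (AdeleRing (𝓞 L) L)ˣ]

/-! ## §3 In the road's currency: the `L²` residue at `2` exists, from ★ `ms2_of_road` -/

/-- **THE `L²` RESIDUE OF A ROAD FAMILY AT `z = 2` EXISTS — (MS-2) PAID BY ★ `ms2_of_road`** (K2E4-p14 (g9) FILE 3): in the currency of one ball of the Bernstein–Lapid road (`U` open,
co-discrete in `ball 0 R`, `R ≥ 3`; `P` closed, co-discrete; `Fam` holomorphic on `U ∖ P` at one level `T₀` with `Fam z =ᵐ Λ^{T₀} Ec z`) plus the structural measures and the (L3)₃ scalar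
letters (`c̃` holomorphic on `{1 < Re} ∖ {2}` with the tube formula and `(z − 2)c̃ → r`): `∃ Res, (z − 2)•Fam z → Res` in `L²(μ)` along `𝓝[≠] 2`.  No Maass–Selberg letter remains.
[cite: MoeglinWaldspurger1995, IV.1.9–IV.1.11] [cite: BernsteinLapid2019, §4 p. 10] -/
theorem exists_L2Residue_of_road_cm_three
    (μ : Measure (quasiSplit (↥(maximalRealSubfield L)) L (IsCMField.complexConj L) 3).automorphicQuotient) [(quasiSplit (↥(maximalRealSubfield L)) L (IsCMField.complexConj L) 3).IsAutomorphicMeasure μ]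
    (νG : Measure (quasiSplit (↥(maximalRealSubfield L)) L (IsCMField.complexConj L) 3).Adelic) [νG.IsHaarMeasure] [νG.IsInvInvariant]
    (μK : Measure ((standardMaximalCompactGL 3 L).comap (adelicVal (↥(maximalRealSubfield L)) L (IsCMField.complexConj L) 3 ((StdForm.antidiagonal 3).over L)) : Subgroup (quasiSplit (↥(maximalRealSubfield L)) L (IsCMField.complexConj L) 3).Adelic))
    [μK.IsHaarMeasure]
    (νI : Measure (AdeleRing (𝓞 L) L)ˣ) [νI.IsHaarMeasure]
    {𝓕I : Set (AdeleRing (𝓞 L) L)ˣ} (h𝓕I : IsIdeleClassDomain L 𝓕I)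
    (ν : Measure ↥(adelicUnipotent (↥(maximalRealSubfield L)) L (IsCMField.complexConj L) 3)) [ν.IsHaarMeasure]
    {𝓕 : Set ↥(adelicUnipotent (↥(maximalRealSubfield L)) L (IsCMField.complexConj L) 3)} (h𝓕N : IsFundamentalDomain ↥(rationalUnipotent (↥(maximalRealSubfield L)) L (IsCMField.complexConj L) 3) 𝓕 ν) (h𝓕1 : ν 𝓕 = 1)
    (h𝓕c : IsCompact (closure 𝓕))
    {β : (quasiSplit (↥(maximalRealSubfield L)) L (IsCMField.complexConj L) 3).Adelic → ℝ≥0∞} (hβ : IsCoveringWeight ((arithmeticBorel (↥(maximalRealSubfield L)) L (IsCMField.complexConj L) 3).map (quasiSplit (↥(maximalRealSubfield L)) L (IsCMField.complexConj L) 3).arithmeticSubgroup.subtype) β)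
    {φ₀ : ℂ}
    {c : ℂ → ℂ} (hchol : DifferentiableOn ℂ c ({z : ℂ | 1 < z.re} \ {2})) (hceq : ∀ z : ℂ, 2 < z.re → c z = (∫ v : ↥(adelicUnipotent (↥(maximalRealSubfield L)) L (IsCMField.complexConj L) 3), (((borelHeight ((quasiSplit (↥(maximalRealSubfield L)) L (IsCMField.complexConj L) 3).toAdelic (weylLongU ((IsCMField.complexConj L : L ≃ₐ[↥(maximalRealSubfield L)] L) : L →+* L) (rfl : (StdForm.antidiagonal 3).over L = (StdForm.antidiagonal 3).over L)) * (v : (quasiSplit (↥(maximalRealSubfield L)) L (IsCMField.complexConj L) 3).Adelic))) : ℝ) : ℂ) ^ z ∂ν))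
    {r : ℂ} (hcres : Tendsto (fun z : ℂ => (z - 2) * c z) (𝓝[≠] 2) (𝓝 r))
    {R : ℝ} (hR : 3 ≤ R) {U P : Set ℂ} (hUo : IsOpen U) (hUcd : ∀ z₀ ∈ Metric.ball (0 : ℂ) R, ∀ᶠ s in 𝓝[≠] z₀, s ∈ U)
    (hPc : IsClosed P) (hPcd : ∀ z₀ : ℂ, ∀ᶠ s in 𝓝[≠] z₀, s ∉ P)
    (Ec : ℂ → (quasiSplit (↥(maximalRealSubfield L)) L (IsCMField.complexConj L) 3).Adelic → ℂ) (hEcE : ∀ z : ℂ, 2 < z.re → Ec z = eisensteinSeriesU (flatSectionU (fun _ : (quasiSplit (↥(maximalRealSubfield L)) L (IsCMField.complexConj L) 3).Adelic => φ₀) z))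
    {T₀ : ℝ≥0} (hT₀ : 1 ≤ T₀) (Fam : ℂ → Lp ℂ 2 μ) (hFd : DifferentiableOn ℂ Fam (U \ P))
    (hFam : ∀ z ∈ U \ P, ((Fam z : Lp ℂ 2 μ) : (quasiSplit (↥(maximalRealSubfield L)) L (IsCMField.complexConj L) 3).automorphicQuotient → ℂ) =ᵐ[μ] (quasiSplit (↥(maximalRealSubfield L)) L (IsCMField.complexConj L) 3).quotFun (truncation ν 𝓕 T₀ (Ec z))) :
    ∃ Res : Lp ℂ 2 μ, Tendsto (fun z : ℂ => (z - 2) • Fam z) (𝓝[≠] 2) (𝓝 Res) := by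
  have h2b : (2 : ℂ) ∈ Metric.ball (0 : ℂ) R := by
    rw [mem_ball_zero_iff]
    have : ‖(2 : ℂ)‖ = 2 := by simp
    linarith
  have hD2 : ∀ᶠ z in 𝓝[≠] (2 : ℂ), z ∈ U \ P := by filter_upwards [hUcd 2 h2b, hPcd 2] with z hU hP using ⟨hU, hP⟩
  exact exists_tendsto_sub_smul_of_differentiableOn (hUo.sdiff hPc) hD2 hFd
    (ms2_of_road L μ νG μK νI h𝓕I ν h𝓕N h𝓕1 h𝓕c hβ hchol hceq hR hUo hUcd hPc hPcd Ec hEcE hT₀ Fam hFd hFam hcres)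

end Road

end CM

end Summit.HodgeConjecture.HodgeConjecture.Cruxes.H413.K2E1SphericalEisensteinL2ResidueCMThree

end
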